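import Summits.Ventures.QEC.Census.CertCheckXZSwap
import Summits.Ventures.QEC.Census.BZAutPermFast
import HarnessLib

/-!
# Kernel-fast form of the `X ↔ Z` swap check (`xzSwapOKFast`) — a bridge, no statement change
# (qec-type-12 g4, on top of qec-type-10's `Census/CertCheckXZSwap.lean` p491526 and `Census/BZAutPermFast.lean` p492806)

`crossMapOK n H H' perm rows` (type-10) transports each row word by `permWord (permFun perm) · n`, whose table look-ups
make it `O(n²)` kernel steps per row — fine for the ≤ 150-qubit one-sided census rows, slow beyond (`≈ 0.7 s` per row at
`n = 270`, i.e. minutes per swap check).  `crossMapOKL` walks the permutation table instead (`permWordL`, `O(n)` per row,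
rows and row maps in lockstep) and `crossMapOK_of_crossMapOKL` / `xzSwapOK_of_fast` / `DistCert.xzSwapOK_of_fast` bridge
to the landed checks, so every consumer theorem of `CertCheckXZSwap.lean` (`dX_eq_dZ_of_xzSwapOK`, `isCode_of_onesided`,
`isCode_of_onesided_lower`) applies verbatim to a `decide +kernel` verdict of the fast form.  Tier KERNEL, axioms standard.
-/

namespace Summit.Ventures.QEC.Census

open Matrix Literature.InformationTheory.QuantumCodes

/-- **Fast cross row-transport check** between two row lists: `rows` has an entry per row of `H` and, walking `H` and
`rows` together, `H'[rows[i]] = permWordL perm H[i]`. (definition, `decide +kernel`) -/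
def crossMapOKL (H H' perm rows : List ℕ) : Bool :=
  (rows.length == H.length) &&
    (H.zip rows).all fun hr => decide (hr.2 < H'.length) && (H'.getD hr.2 0 == permWordL perm hr.1)

variable {n : ℕ}

/-- The fast cross check implies type-10's `crossMapOK` (valid permutation table). -/
theorem crossMapOK_of_crossMapOKL {H H' perm rows : List ℕ} (hperm : permListOK n perm = true)
    (h : crossMapOKL H H' perm rows = true) : crossMapOK n H H' perm rows = true := by
  simp only [crossMapOKL, Bool.and_eq_true, beq_iff_eq, List.all_eq_true, decide_eq_true_eq] at h
  obtain ⟨hlen, hall⟩ := h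
  simp only [crossMapOK, List.all_eq_true, List.mem_range, Bool.and_eq_true, decide_eq_true_eq, beq_iff_eq]
  intro i hi
  have hi' : i < rows.length := by rw [hlen]; exact hi
  have hmem : (H[i], rows[i]) ∈ H.zip rows := by
    rw [List.mem_iff_getElem]
    exact ⟨i, by rw [List.length_zip]; exact lt_min hi hi', by rw [List.getElem_zip]⟩
  obtain ⟨hlt, heq⟩ := hall _ hmem
  simp only at hlt heq
  have e1 : rows.getD i 0 = rows[i] := by
    rw [List.getD_eq_getElem?_getD, List.getElem?_eq_getElem hi', Option.getD_some]
  have e2 : H.getD i 0 = H[i] := by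
    rw [List.getD_eq_getElem?_getD, List.getElem?_eq_getElem hi, Option.getD_some]
  rw [e1, e2]
  exact ⟨hlt, by rw [heq, permWordL_eq_of_permListOK hperm]⟩

/-- **Fast `X ↔ Z` swap check**: valid table and both cross checks in the fast form. (definition, `decide +kernel`) -/
def xzSwapOKFast (n : ℕ) (HX HZ : List ℕ) (sw : XZSwap) : Bool :=
  permListOK n sw.perm && crossMapOKL HX HZ sw.perm sw.rowsXZ && crossMapOKL HZ HX sw.perm sw.rowsZX

/-- **Bridge**: the fast swap check implies `xzSwapOK`. -/
theorem xzSwapOK_of_fast {HX HZ : List ℕ} {sw : XZSwap} (h : xzSwapOKFast n HX HZ sw = true) :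
    xzSwapOK n HX HZ sw = true := by
  simp only [xzSwapOKFast, Bool.and_eq_true] at h
  obtain ⟨⟨hp, h1⟩, h2⟩ := h
  simp only [xzSwapOK, Bool.and_eq_true]
  exact ⟨⟨hp, crossMapOK_of_crossMapOKL hp h1⟩, crossMapOK_of_crossMapOKL hp h2⟩

namespace DistCert

/-- The fast swap check against a certificate's own matrices. (definition) -/
def xzSwapOKFast (c : DistCert) (sw : XZSwap) : Bool := Census.xzSwapOKFast c.n c.HX c.HZ sw

/-- **Bridge, certificate form**: `c.xzSwapOKFast sw = true → c.xzSwapOK sw = true` (then `dX_eq_dZ_of_xzSwapOK`,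
`isCode_of_onesided`, `isCode_of_onesided_lower` apply verbatim). -/
theorem xzSwapOK_of_fast {c : DistCert} {sw : XZSwap} (h : c.xzSwapOKFast sw = true) : c.xzSwapOK sw = true :=
  Census.xzSwapOK_of_fast h

end DistCert

/-! ## Controls (kernel `decide`): the fast form agrees with type-10's controls -/

/-- `[[4,2,2]]`: the identity swap passes the fast check (as it passes `xzSwapOK`, `xzSwapOK_certC422`). -/
example : certC422.xzSwapOKFast ⟨[0, 1, 2, 3], [0], [0]⟩ = true := by decide

/-- Steane: the identity swap with row maps `[0,1,2]` passes the fast check (cf. `xzSwapOK_certSteane7`). -/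
example : certSteane7.xzSwapOKFast ⟨[0, 1, 2, 3, 4, 5, 6], [0, 1, 2], [0, 1, 2]⟩ = true := by decide

end Summit.Ventures.QEC.Census
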